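import Literature.Analysis.Hypoelliptic.AprioriEstimate
import Literature.Analysis.Hypoelliptic.Regulariser
import HarnessLib

/-!
# Commuting the regularisers `e^{-δ⟨D⟩}` past a Hörmander operator with flat coefficients, uniformly in `δ`

Analysis/Hypoelliptic support file serving the discharge of
`Literature.Analysis.Distribution.Hormander1967_thm11` by Kohn's method (M. Taylor,
*Pseudodifferential Operators* (1981), Ch. XV §1, the uniform commutator bounds (1.22)–(1.25)
behind the regularised estimate (1.26)).

Here the fields have FLAT coefficients `c_k + 𝓕a_k` (`FlatField`): on the Fourier side
`X H = ∑_k (c_k + conv θ_k)(2πi⟪·, b_k⟫ H)`. For such `X` and the regularising multiplier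
`m_δ` of `Regulariser.lean` we prove, for functions `H` in a single `Ĥ^t` (not only `Nice`
ones — the point of the bootstrap), with constants INDEPENDENT of `δ ≥ 0`:

* `X (m_δ H) = m_δ X H - R_δ H` with `‖R_δ H‖_s ≤ C ‖H‖_s` (`applyF_reg_mul`, `rn_RF_le`);
* `X (R_δ G) = R_δ (X G) + Q_δ G` with `Q_δ G ∈ Ĥ^t`, `‖Q_δ G‖_t ≤ C ‖G‖_t` (`applyF_RF`, `rn_QF_le`) — the
  second-commutator bookkeeping `[X, [X, m_δ]] ∈ OPS⁰` uniformly, through the explicit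
  kernels `commConvKer` (first differences of `m_δ`) and `dcommKer` (second differences).

## References

* M. E. Taylor, *Pseudodifferential Operators* (1981), Ch. XV §1, (1.22)–(1.26).
-/

noncomputable section

open MeasureTheory Set Filter Function
open scoped ENNReal NNReal Topology ComplexConjugate InnerProductSpace BigOperators

namespace Literature.Analysis.Hypoelliptic

variable {V : Type*} [NormedAddCommGroup V] [InnerProductSpace ℝ V] [FiniteDimensional ℝ V]
  [MeasurableSpace V] [BorelSpace V]

/-! ### Kernel operators on finite sums; real-norm form of the Schur bound -/

/-- A kernel operator distributes over finite sums of `Ĥ^t` functions. [folklore] -/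
theorem KerDecay.kerOp_finset_sum {K : V → V → ℂ} {m : ℝ} {C : ℕ → ℝ} (h : KerDecay K m C)
    {ι : Type*} (S : Finset ι) {t : ℝ} {F : ι → V → ℂ} (hF : ∀ i, InH t (F i)) :
    kerOp K (fun η => ∑ i ∈ S, F i η) = fun ξ => ∑ i ∈ S, kerOp K (F i) ξ := by
  classical
  induction S using Finset.induction_on with
  | empty => ext ξ; simp [kerOp]
  | insert a S ha ih =>
    have hS : InH t (fun η => ∑ i ∈ S, F i η) := by
      refine ⟨Finset.aestronglyMeasurable_fun_sum S fun i _ => (hF i).1, ?_⟩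
      exact (wnorm_finset_sum_le S t fun i => (hF i).1).trans_lt
        (ENNReal.sum_lt_top.2 fun i _ => (hF i).2)
    simp only [Finset.sum_insert ha]
    rw [h.kerOp_add (hF a) hS, ih]

/-- `InH` for finite sums. [folklore] -/
theorem InH.finset_sum {ι : Type*} (S : Finset ι) {t : ℝ} {F : ι → V → ℂ} (hF : ∀ i, InH t (F i)) :
    InH t (fun η => ∑ i ∈ S, F i η) :=
  ⟨Finset.aestronglyMeasurable_fun_sum S fun i _ => (hF i).1,
    (wnorm_finset_sum_le S t fun i => (hF i).1).trans_lt (ENNReal.sum_lt_top.2 fun i _ => (hF i).2)⟩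

/-- The Schur bound in real form: `‖kerOp K F‖_{s-m} ≤ schurConst · ‖F‖_s`. [folklore] -/
theorem KerDecay.rn_kerOp_le {K : V → V → ℂ} {m : ℝ} {C : ℕ → ℝ} (h : KerDecay K m C) (s : ℝ)
    {F : V → ℂ} (hF : InH s F) :
    rn (s - m) (kerOp K F) ≤ schurConst V (s - m) C * rn s F := by
  unfold rn
  have := ENNReal.toReal_mono (ENNReal.mul_ne_top ENNReal.ofReal_ne_top hF.2.ne) (wnorm_kerOp_le h s hF.1)
  rwa [ENNReal.toReal_mul, ENNReal.toReal_ofReal (schurConst_nonneg h.nonneg _)] at this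

/-- Subadditivity of the real norms on `Ĥ^t`. [folklore] -/
theorem InH.rn_add_le {t : ℝ} {F G : V → ℂ} (hF : InH t F) (hG : InH t G) :
    rn t (fun ξ => F ξ + G ξ) ≤ rn t F + rn t G := by
  unfold rn
  rw [← ENNReal.toReal_add hF.2.ne hG.2.ne]
  exact ENNReal.toReal_mono (ENNReal.add_ne_top.2 ⟨hF.2.ne, hG.2.ne⟩) (wnorm_add_le hF.1 hG.1)

/-- Real norms of differences on `Ĥ^t`. [folklore] -/
theorem InH.rn_sub_le {t : ℝ} {F G : V → ℂ} (hF : InH t F) (hG : InH t G) :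
    rn t (fun ξ => F ξ - G ξ) ≤ rn t F + rn t G := by
  unfold rn
  rw [← ENNReal.toReal_add hF.2.ne hG.2.ne]
  exact ENNReal.toReal_mono (ENNReal.add_ne_top.2 ⟨hF.2.ne, hG.2.ne⟩) (wnorm_sub_le hF.1 hG.1)

/-- Real norms of finite sums on `Ĥ^t`. [folklore] -/
theorem InH.rn_finset_sum_le {ι : Type*} (S : Finset ι) {t : ℝ} {F : ι → V → ℂ}
    (hF : ∀ i, InH t (F i)) : rn t (fun ξ => ∑ i ∈ S, F i ξ) ≤ ∑ i ∈ S, rn t (F i) := by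
  unfold rn
  rw [← ENNReal.toReal_sum (fun i _ => (hF i).2.ne)]
  exact ENNReal.toReal_mono (ENNReal.sum_ne_top.2 fun i _ => (hF i).2.ne)
    (wnorm_finset_sum_le _ _ fun i => (hF i).1)

/-- A multiplier bound in real form: `‖φ F‖_{s-m} ≤ c ‖F‖_s`. [folklore] -/
theorem MulBound.rn_mul_le {φ : V → ℂ} {m c : ℝ} (h : MulBound φ m c) (s : ℝ) {F : V → ℂ}
    (hF : InH s F) : rn (s - m) (fun ξ => φ ξ * F ξ) ≤ c * rn s F := by
  unfold rn
  have := ENNReal.toReal_mono (ENNReal.mul_ne_top ENNReal.ofReal_ne_top hF.2.ne)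
    (wnorm_mul_le h.nonneg h.bound s F)
  rwa [ENNReal.toReal_mul, ENNReal.toReal_ofReal h.nonneg] at this

/-- The linear symbol as a multiplier in real norms: `‖2πi⟪·,v⟫ F‖_{s-1} ≤ 2π‖v‖ ‖F‖_s`.
[folklore] -/
theorem rn_linMul_le (v : V) (s : ℝ) {F : V → ℂ} (hF : InH s F) :
    rn (s - 1) (fun ξ => linMul v ξ * F ξ) ≤ 2 * Real.pi * ‖v‖ * rn s F :=
  (mulBound_linMul v).rn_mul_le s hF

/-- `2πi⟪·,v⟫ F ∈ Ĥ^{s-1}` for `F ∈ Ĥ^s`. [folklore] -/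
theorem inH_linMul (v : V) {s : ℝ} {F : V → ℂ} (hF : InH s F) :
    InH (s - 1) (fun ξ => linMul v ξ * F ξ) :=
  (mulBound_linMul v).inH_mul hF

/-! ### Flat fields -/

variable (V) in
/-- **A field with flat coefficients** `c_k + 𝓕a_k` (`θ_k = 𝓕a_k` rapidly decreasing), one per
direction `b_k`. [folklore] -/
structure FlatField (ι : Type*) where
  /-- the constant parts of the coefficients [folklore] -/
  c : ι → ℂ
  /-- the Fourier transforms of the variable parts of the coefficients [folklore] -/
  θ : ι → V → ℂ
  /-- decay constants [folklore] -/
  D : ι → ℕ → ℝ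
  decay : ∀ k, RapidDecay (θ k) (D k)

namespace FlatField

variable {ι : Type*} [Fintype ι] (F : FlatField V ι) (b : ι → V)

/-- `∂_k H` on the Fourier side: `2πi⟪·, b_k⟫ H`. [folklore] -/
def L (k : ι) (H : V → ℂ) : V → ℂ := fun η => linMul (b k) η * H η

/-- **The action of a flat field** `X H = ∑_k (c_k + conv θ_k)(∂_k H)`. [folklore] -/
def applyF (H : V → ℂ) : V → ℂ :=
  fun ξ => ∑ k, (F.c k * L b k H ξ + kerOp (convKer (F.θ k)) (L b k H) ξ)

/-- The commutator kernel `[m_δ, conv θ_k]`. [folklore] -/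
def Kr (δ : ℝ) (k : ι) : V → V → ℂ := commConvKer (reg δ) (F.θ k)

/-- **The remainder** `R_δ H = ∑_k [m_δ, conv θ_k](∂_k H)`, so that `X (m_δ H) = m_δ X H - R_δ H`.
[folklore] -/
def RF (δ : ℝ) (H : V → ℂ) : V → ℂ := fun ξ => ∑ k, kerOp (F.Kr δ k) (L b k H) ξ

/-- The first-difference constants of `m_δ` (independent of `δ`). [folklore] -/
def dreg : ℝ := 2 * (1 / 2) * 2 ^ (|(0 : ℝ) - 1| / 2)

/-- The Peetre exponent of the first differences of `m_δ`. [folklore] -/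
def Mreg : ℝ := |(0 : ℝ) - 1| + 1

omit [Fintype ι] in
/-- The certificate of `Kr`: order `-1`, constants independent of `δ ≥ 0`. [folklore] -/
theorem kerDecay_Kr {δ : ℝ} (hδ : 0 ≤ δ) (k : ι) :
    KerDecay (F.Kr δ k) (-1) (fun N => dreg * F.D k (N + ⌈Mreg⌉₊)) :=
  (mulDiff_reg hδ).kerDecay_commConvKer (F.decay k)

omit [Fintype ι] in
/-- `∂_k H ∈ Ĥ^{t-1}`. [folklore] -/
theorem inH_L (k : ι) {t : ℝ} {H : V → ℂ} (hH : InH t H) : InH (t - 1) (L b k H) :=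
  inH_linMul (b k) hH

/-- `X H ∈ Ĥ^{t-1}` for `H ∈ Ĥ^t`. [folklore] -/
theorem inH_applyF {t : ℝ} {H : V → ℂ} (hH : InH t H) : InH (t - 1) (F.applyF b H) := by
  unfold applyF
  refine InH.finset_sum _ fun k => ?_
  have h1 := (inH_L b k hH).const_mul (F.c k)
  have h2 := (F.decay k).kerDecay_convKer.inH_kerOp (inH_L b k hH)
  rw [sub_zero] at h2
  exact h1.add h2

/-- `R_δ H ∈ Ĥ^{t}` for `H ∈ Ĥ^t` (the gain of one order). [folklore] -/
theorem inH_RF {δ : ℝ} (hδ : 0 ≤ δ) {t : ℝ} {H : V → ℂ} (hH : InH t H) : InH t (F.RF b δ H) := by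
  unfold RF
  refine InH.finset_sum _ fun k => ?_
  have h := (F.kerDecay_Kr hδ k).inH_kerOp (inH_L b k hH)
  rwa [show t - 1 - (-1 : ℝ) = t by ring] at h

/-! ### `X (m_δ H) = m_δ X H - R_δ H` -/

/-- **Commuting the regulariser past a flat field**: `X (m_δ H) = m_δ (X H) - R_δ H` for
`H ∈ Ĥ^t`. [folklore] -/
theorem applyF_reg_mul {δ : ℝ} (hδ : 0 ≤ δ) {t : ℝ} {H : V → ℂ} (hH : InH t H) :
    F.applyF b (fun η => reg δ η * H η) = fun ξ => reg δ ξ * F.applyF b H ξ - F.RF b δ H ξ := by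
  ext ξ
  unfold applyF RF
  rw [Finset.mul_sum, ← Finset.sum_sub_distrib]
  refine Finset.sum_congr rfl fun k _ => ?_
  -- `L_k (m H) = m (L_k H)`
  have hL : L b k (fun η => reg δ η * H η) = fun η => reg δ η * L b k H η := by
    ext η; simp only [L]; ring
  have hc := (F.decay k).kerDecay_convKer.comm_mul_kerOp (mulBound_reg hδ) (inH_L b k hH)
  have hcξ := congrFun hc ξ
  try simp only at hcξ
  rw [hL]
  change F.c k * (reg δ ξ * L b k H ξ) + kerOp (convKer (F.θ k)) (fun η => reg δ η * L b k H η) ξ =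
    reg δ ξ * (F.c k * L b k H ξ + kerOp (convKer (F.θ k)) (L b k H) ξ) -
      kerOp (commConvKer (reg δ) (F.θ k)) (L b k H) ξ
  rw [commConvKer_eq]
  linear_combination -hcξ

/-- Linearity of a flat field on `Ĥ^t`. [folklore] -/
theorem applyF_sub {t : ℝ} {H₁ H₂ : V → ℂ} (h₁ : InH t H₁) (h₂ : InH t H₂) :
    F.applyF b (fun η => H₁ η - H₂ η) = fun ξ => F.applyF b H₁ ξ - F.applyF b H₂ ξ := by
  ext ξ
  unfold applyF
  rw [← Finset.sum_sub_distrib]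
  refine Finset.sum_congr rfl fun k _ => ?_
  have hL : L b k (fun η => H₁ η - H₂ η) = fun η => L b k H₁ η - L b k H₂ η := by
    ext η; simp only [L]; ring
  rw [hL, (F.decay k).kerDecay_convKer.kerOp_sub (inH_L b k h₁) (inH_L b k h₂)]
  simp only [L]
  ring

/-- Additivity of a flat field on `Ĥ^t`. [folklore] -/
theorem applyF_add {t : ℝ} {H₁ H₂ : V → ℂ} (h₁ : InH t H₁) (h₂ : InH t H₂) :
    F.applyF b (fun η => H₁ η + H₂ η) = fun ξ => F.applyF b H₁ ξ + F.applyF b H₂ ξ := by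
  have h := F.applyF_sub b (h₁.add h₂) h₂
  have e : (fun η => H₁ η + H₂ η - H₂ η) = H₁ := by ext η; ring
  rw [e] at h
  ext ξ
  have := congrFun h ξ
  try simp only at this
  linear_combination -this

/-! ### Norm bounds, uniform in `δ` -/

omit [Fintype ι] in
/-- The `k`-th term of `X H` is in `Ĥ^s` when `∂_k H` is. [folklore] -/
theorem inH_term (k : ι) {s : ℝ} {M : V → ℂ} (hM : InH s M) :
    InH s (fun ξ => F.c k * M ξ + kerOp (convKer (F.θ k)) M ξ) := by
  have h2 := (F.decay k).kerDecay_convKer.inH_kerOp hM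
  rw [sub_zero] at h2
  exact (hM.const_mul _).add h2

omit [Fintype ι] in
/-- The bound of the `k`-th term: `‖c_k M + conv θ_k M‖_s ≤ (‖c_k‖ + schur) ‖M‖_s`. [folklore] -/
theorem rn_term_le (k : ι) (s : ℝ) {M : V → ℂ} (hM : InH s M) :
    rn s (fun ξ => F.c k * M ξ + kerOp (convKer (F.θ k)) M ξ) ≤
      (‖F.c k‖ + schurConst V s (F.D k)) * rn s M := by
  have h2 := (F.decay k).kerDecay_convKer.inH_kerOp hM
  rw [sub_zero] at h2
  refine ((hM.const_mul _).rn_add_le h2).trans ?_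
  rw [rn_const_mul]
  have h3 := (F.decay k).kerDecay_convKer.rn_kerOp_le s hM
  rw [sub_zero] at h3
  nlinarith only [h3, rn_nonneg s M, norm_nonneg (F.c k)]

/-- The constant of `‖X H‖_s ≤ C ‖H‖_{s+1}`. [folklore] -/
def CX (s : ℝ) : ℝ := ∑ k, (‖F.c k‖ + schurConst V s (F.D k)) * (2 * Real.pi * ‖b k‖)

/-- `CX ≥ 0`. [folklore] -/
theorem CX_nonneg (s : ℝ) : 0 ≤ F.CX b s :=
  Finset.sum_nonneg fun k _ => mul_nonneg (add_nonneg (norm_nonneg _)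
    (schurConst_nonneg (F.decay k).nonneg _)) (by positivity)

/-- **`‖X H‖_s ≤ C ‖H‖_{s+1}`.** [folklore] -/
theorem rn_applyF_le (s : ℝ) {H : V → ℂ} (hH : InH (s + 1) H) :
    rn s (F.applyF b H) ≤ F.CX b s * rn (s + 1) H := by
  have hL : ∀ k, InH s (L b k H) := fun k => by
    have := inH_L b k hH; rwa [add_sub_cancel_right] at this
  have hLn : ∀ k, rn s (L b k H) ≤ 2 * Real.pi * ‖b k‖ * rn (s + 1) H := fun k => by
    have := rn_linMul_le (b k) (s + 1) hH; rwa [add_sub_cancel_right] at this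
  unfold applyF CX
  refine (InH.rn_finset_sum_le _ fun k => F.inH_term k (hL k)).trans ?_
  rw [Finset.sum_mul]
  refine Finset.sum_le_sum fun k _ => (F.rn_term_le k s (hL k)).trans ?_
  have h0 : 0 ≤ ‖F.c k‖ + schurConst V s (F.D k) :=
    add_nonneg (norm_nonneg _) (schurConst_nonneg (F.decay k).nonneg _)
  calc (‖F.c k‖ + schurConst V s (F.D k)) * rn s (L b k H)
      ≤ (‖F.c k‖ + schurConst V s (F.D k)) * (2 * Real.pi * ‖b k‖ * rn (s + 1) H) :=
        mul_le_mul_of_nonneg_left (hLn k) h0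
    _ = _ := by ring

/-- The constant of `‖R_δ H‖_s ≤ C ‖H‖_s` (independent of `δ`). [folklore] -/
def CR (s : ℝ) : ℝ :=
  ∑ k, schurConst V s (fun N => dreg * F.D k (N + ⌈Mreg⌉₊)) * (2 * Real.pi * ‖b k‖)

omit [Fintype ι] in
/-- `dreg ≥ 0`. [folklore] -/
theorem dreg_nonneg : 0 ≤ dreg := by unfold dreg; positivity

/-- `CR ≥ 0`. [folklore] -/
theorem CR_nonneg (s : ℝ) : 0 ≤ F.CR b s :=
  Finset.sum_nonneg fun k _ => mul_nonneg (schurConst_nonneg (fun N =>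
    mul_nonneg dreg_nonneg ((F.decay k).nonneg _)) _) (by positivity)

/-- **`‖R_δ H‖_s ≤ C ‖H‖_s` uniformly in `δ ≥ 0`.** [folklore] -/
theorem rn_RF_le {δ : ℝ} (hδ : 0 ≤ δ) (s : ℝ) {H : V → ℂ} (hH : InH s H) :
    rn s (F.RF b δ H) ≤ F.CR b s * rn s H := by
  have hL : ∀ k, InH (s - 1) (L b k H) := fun k => inH_L b k hH
  have hK : ∀ k, InH s (kerOp (F.Kr δ k) (L b k H)) := fun k => by
    have h := (F.kerDecay_Kr hδ k).inH_kerOp (hL k)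
    rwa [show s - 1 - (-1 : ℝ) = s by ring] at h
  unfold RF CR
  refine (InH.rn_finset_sum_le _ hK).trans ?_
  rw [Finset.sum_mul]
  refine Finset.sum_le_sum fun k _ => ?_
  have h1 := (F.kerDecay_Kr hδ k).rn_kerOp_le (s - 1) (hL k)
  rw [show s - 1 - (-1 : ℝ) = s by ring] at h1
  have h2 := rn_linMul_le (b k) s hH
  have h0 := schurConst_nonneg (V := V) (fun N => mul_nonneg dreg_nonneg ((F.decay k).nonneg (N + ⌈Mreg⌉₊))) s
  calc rn s (kerOp (F.Kr δ k) (L b k H))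
      ≤ schurConst V s (fun N => dreg * F.D k (N + ⌈Mreg⌉₊)) * rn (s - 1) (L b k H) := h1
    _ ≤ schurConst V s (fun N => dreg * F.D k (N + ⌈Mreg⌉₊)) * (2 * Real.pi * ‖b k‖ * rn s H) :=
        mul_le_mul_of_nonneg_left h2 h0
    _ = _ := by ring

/-! ### The second commutation: `X (R_δ G) = R_δ (X G) + Q_δ G` -/

/-- The kernel `[m_δ, conv (2πi⟪·,b_l⟫ θ_k)]` (first differences of `m_δ` against the derivative
of a coefficient). [folklore] -/
def Kp (δ : ℝ) (k l : ι) : V → V → ℂ := commConvKer (reg δ) (fun ζ => linMul (b l) ζ * F.θ k ζ)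

omit [Fintype ι] in
/-- Its certificate: order `-1`, constants independent of `δ`. [folklore] -/
theorem kerDecay_Kp {δ : ℝ} (hδ : 0 ≤ δ) (k l : ι) :
    KerDecay (F.Kp b δ k l) (-1)
      (fun N => dreg * (2 * Real.pi * ‖b l‖ * F.D k (N + ⌈Mreg⌉₊ + 1))) :=
  (mulDiff_reg hδ).kerDecay_commConvKer ((F.decay k).linMul_mul (b l))

omit [Fintype ι] [FiniteDimensional ℝ V] [BorelSpace V] in
/-- `[2πi⟪·,b_l⟫, K] = Kp` for `K = Kr k`: the kernel identity. [folklore] -/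
theorem linMul_sub_mul_Kr (δ : ℝ) (k l : ι) (ξ η : V) :
    (linMul (b l) ξ - linMul (b l) η) * F.Kr δ k ξ η = F.Kp b δ k l ξ η := by
  simp only [Kr, Kp, commConvKer, linMul_sub]
  ring

/-- **The correction** `Q_δ G` of the second commutation, explicitly:
`∑_{k,l} ( c_l Kp_{kl} ∂_k G + conv θ_l (Kp_{kl} ∂_k G) + dcomm_{l,k} ∂_l ∂_k G
  - Kr_k (conv(2πi⟪·,b_k⟫θ_l) ∂_l G) )`. [folklore] -/
def QF (δ : ℝ) (G : V → ℂ) : V → ℂ := fun ξ =>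
  ∑ k, ∑ l, (F.c l * kerOp (F.Kp b δ k l) (L b k G) ξ +
    kerOp (convKer (F.θ l)) (kerOp (F.Kp b δ k l) (L b k G)) ξ +
    kerOp (dcommKer (F.θ l) (F.θ k) (reg δ)) (L b l (L b k G)) ξ -
    kerOp (F.Kr δ k) (kerOp (convKer (fun ζ => linMul (b k) ζ * F.θ l ζ)) (L b l G)) ξ)

omit [Fintype ι] in
/-- The `(k,l)` identity behind `X (R_δ G) = R_δ (X G) + Q_δ G`. [folklore] -/
theorem term_comm {δ : ℝ} (hδ : 0 ≤ δ) (k l : ι) {t : ℝ} {G : V → ℂ} (hG : InH t G) (ξ : V) :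
    F.c l * L b l (kerOp (F.Kr δ k) (L b k G)) ξ +
        kerOp (convKer (F.θ l)) (L b l (kerOp (F.Kr δ k) (L b k G))) ξ =
      kerOp (F.Kr δ k) (L b k (fun η => F.c l * L b l G η + kerOp (convKer (F.θ l)) (L b l G) η)) ξ +
      (F.c l * kerOp (F.Kp b δ k l) (L b k G) ξ +
        kerOp (convKer (F.θ l)) (kerOp (F.Kp b δ k l) (L b k G)) ξ +
        kerOp (dcommKer (F.θ l) (F.θ k) (reg δ)) (L b l (L b k G)) ξ -
        kerOp (F.Kr δ k) (kerOp (convKer (fun ζ => linMul (b k) ζ * F.θ l ζ)) (L b l G)) ξ) := by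
  -- abbreviations
  have hKr := F.kerDecay_Kr hδ k
  have hA := (F.decay l).kerDecay_convKer
  have hLk : InH (t - 1) (L b k G) := inH_L b k hG
  have hLl : InH (t - 1) (L b l G) := inH_L b l hG
  have hKL : InH t (kerOp (F.Kr δ k) (L b k G)) := by
    have h := hKr.inH_kerOp hLk; rwa [show t - 1 - (-1 : ℝ) = t by ring] at h
  have hW : InH (t - 1 - 1) (L b l (L b k G)) := inH_L b l hLk
  -- (1) `lin_l (Kr L_k) = Kr (lin_l L_k) + Kp L_k`
  have h1 := hKr.comm_mul_kerOp (mulBound_linMul (b l)) hLk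
  have h1' : L b l (kerOp (F.Kr δ k) (L b k G)) = fun ζ =>
      kerOp (F.Kr δ k) (L b l (L b k G)) ζ + kerOp (F.Kp b δ k l) (L b k G) ζ := by
    ext ζ
    have hζ := congrFun h1 ζ
    have e : kerOp (fun ξ η => (linMul (b l) ξ - linMul (b l) η) * F.Kr δ k ξ η) (L b k G) ζ =
        kerOp (F.Kp b δ k l) (L b k G) ζ := by
      congr 1; ext ξ η; exact F.linMul_sub_mul_Kr b δ k l ξ η
    change linMul (b l) ζ * kerOp (F.Kr δ k) (L b k G) ζ - kerOp (F.Kr δ k) (L b l (L b k G)) ζ = _ at hζ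
    rw [e] at hζ
    change linMul (b l) ζ * kerOp (F.Kr δ k) (L b k G) ζ = _
    linear_combination hζ
  -- (2) `conv θ_l` applied to (1)
  have hKW : InH (t - 1) (kerOp (F.Kr δ k) (L b l (L b k G))) := by
    have h := hKr.inH_kerOp hW; rwa [show t - 1 - 1 - (-1 : ℝ) = t - 1 by ring] at h
  have hKpL : InH t (kerOp (F.Kp b δ k l) (L b k G)) := by
    have h := (F.kerDecay_Kp b hδ k l).inH_kerOp hLk; rwa [show t - 1 - (-1 : ℝ) = t by ring] at h
  have h2 : kerOp (convKer (F.θ l)) (L b l (kerOp (F.Kr δ k) (L b k G))) = fun ζ =>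
      kerOp (convKer (F.θ l)) (kerOp (F.Kr δ k) (L b l (L b k G))) ζ +
        kerOp (convKer (F.θ l)) (kerOp (F.Kp b δ k l) (L b k G)) ζ := by
    rw [h1', hA.kerOp_add hKW hKpL]
  -- (3) the other side: `Kr (lin_k (c_l L_l + conv θ_l L_l)) = Kr (c_l W) + Kr (lin_k (conv θ_l L_l))`
  have hAL : InH (t - 1) (kerOp (convKer (F.θ l)) (L b l G)) := by
    have h := hA.inH_kerOp hLl; rwa [sub_zero] at h
  have e3 : L b k (fun η => F.c l * L b l G η + kerOp (convKer (F.θ l)) (L b l G) η) = fun η =>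
      F.c l * L b l (L b k G) η + L b k (kerOp (convKer (F.θ l)) (L b l G)) η := by
    ext η; simp only [L]; ring
  have hW' : InH (t - 1 - 1) (fun η => F.c l * L b l (L b k G) η) := hW.const_mul _
  have hLA : InH (t - 1 - 1) (L b k (kerOp (convKer (F.θ l)) (L b l G))) := inH_L b k hAL
  have h3 : kerOp (F.Kr δ k) (L b k (fun η => F.c l * L b l G η + kerOp (convKer (F.θ l)) (L b l G) η)) =
      fun ζ => F.c l * kerOp (F.Kr δ k) (L b l (L b k G)) ζ +
        kerOp (F.Kr δ k) (L b k (kerOp (convKer (F.θ l)) (L b l G))) ζ := by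
    rw [e3, hKr.kerOp_add hW' hLA, kerOp_const_mul]
  -- (4) `lin_k (conv θ_l L_l) = conv θ_l (lin_k L_l) + conv(lin_k θ_l) L_l`
  have h4 := hA.comm_mul_kerOp (mulBound_linMul (b k)) hLl
  have h4' : L b k (kerOp (convKer (F.θ l)) (L b l G)) = fun ζ =>
      kerOp (convKer (F.θ l)) (L b l (L b k G)) ζ +
        kerOp (convKer (fun ζ => linMul (b k) ζ * F.θ l ζ)) (L b l G) ζ := by
    have eW : L b k (L b l G) = L b l (L b k G) := by ext η; simp only [L]; ring
    ext ζ
    have hζ := congrFun h4 ζ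
    have e : kerOp (fun ξ η => (linMul (b k) ξ - linMul (b k) η) * convKer (F.θ l) ξ η) (L b l G) ζ =
        kerOp (convKer (fun ζ => linMul (b k) ζ * F.θ l ζ)) (L b l G) ζ := by
      congr 1; ext ξ η; simp only [convKer, linMul_sub]
    change linMul (b k) ζ * kerOp (convKer (F.θ l)) (L b l G) ζ -
      kerOp (convKer (F.θ l)) (L b k (L b l G)) ζ = _ at hζ
    rw [e, eW] at hζ
    change linMul (b k) ζ * kerOp (convKer (F.θ l)) (L b l G) ζ = _
    linear_combination hζ
  have hALk : InH (t - 1 - 1) (kerOp (convKer (F.θ l)) (L b l (L b k G))) := by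
    have h := hA.inH_kerOp hW; rwa [sub_zero] at h
  have hCL : InH (t - 1) (kerOp (convKer (fun ζ => linMul (b k) ζ * F.θ l ζ)) (L b l G)) := by
    have h := ((F.decay l).linMul_mul (b k)).kerDecay_convKer.inH_kerOp hLl; rwa [sub_zero] at h
  have h5 : kerOp (F.Kr δ k) (L b k (kerOp (convKer (F.θ l)) (L b l G))) = fun ζ =>
      kerOp (F.Kr δ k) (kerOp (convKer (F.θ l)) (L b l (L b k G))) ζ +
        kerOp (F.Kr δ k) (kerOp (convKer (fun ζ => linMul (b k) ζ * F.θ l ζ)) (L b l G)) ζ := by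
    rw [h4', hKr.kerOp_add hALk hCL]
  -- (5) the double commutator
  have h6 := congrFun (kerOp_dcomm (F.decay l) (F.decay k) (mulDiff_reg (V := V) hδ) hW) ξ
  try simp only at h6
  change kerOp (convKer (F.θ l)) (kerOp (F.Kr δ k) (L b l (L b k G))) ξ -
      kerOp (F.Kr δ k) (kerOp (convKer (F.θ l)) (L b l (L b k G))) ξ =
    kerOp (dcommKer (F.θ l) (F.θ k) (reg δ)) (L b l (L b k G)) ξ at h6
  -- assemble
  rw [congrFun h1' ξ, h2]
  beta_reduce
  rw [h3]
  beta_reduce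
  rw [h5]
  beta_reduce
  linear_combination h6

/-- **The second commutation**: `X (R_δ G) = R_δ (X G) + Q_δ G` for `G ∈ Ĥ^t`. [folklore] -/
theorem applyF_RF {δ : ℝ} (hδ : 0 ≤ δ) {t : ℝ} {G : V → ℂ} (hG : InH t G) :
    F.applyF b (F.RF b δ G) = fun ξ => F.RF b δ (F.applyF b G) ξ + F.QF b δ G ξ := by
  have hKr := fun k => F.kerDecay_Kr hδ k
  have hKL : ∀ k, InH t (kerOp (F.Kr δ k) (L b k G)) := fun k => by
    have h := (hKr k).inH_kerOp (inH_L b k hG); rwa [show t - 1 - (-1 : ℝ) = t by ring] at h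
  ext ξ
  -- left side: `∑_l (c_l lin_l (RF G) + conv θ_l (lin_l (RF G)))` with `RF G = ∑_k Kr_k L_k`
  have hleft : F.applyF b (F.RF b δ G) ξ = ∑ l, ∑ k,
      (F.c l * L b l (kerOp (F.Kr δ k) (L b k G)) ξ +
        kerOp (convKer (F.θ l)) (L b l (kerOp (F.Kr δ k) (L b k G))) ξ) := by
    unfold applyF
    refine Finset.sum_congr rfl fun l _ => ?_
    have eL : L b l (F.RF b δ G) = fun η => ∑ k, L b l (kerOp (F.Kr δ k) (L b k G)) η := by
      ext η; simp only [L, RF, Finset.mul_sum]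
    rw [eL, (F.decay l).kerDecay_convKer.kerOp_finset_sum _ (fun k => inH_L b l (hKL k)),
      Finset.mul_sum, ← Finset.sum_add_distrib]
  -- right side
  have hterm : ∀ l, InH (t - 1) (fun η => F.c l * L b l G η + kerOp (convKer (F.θ l)) (L b l G) η) :=
    fun l => F.inH_term l (inH_L b l hG)
  have hright : F.RF b δ (F.applyF b G) ξ = ∑ k, ∑ l,
      kerOp (F.Kr δ k) (L b k (fun η => F.c l * L b l G η + kerOp (convKer (F.θ l)) (L b l G) η)) ξ := by
    unfold RF
    refine Finset.sum_congr rfl fun k _ => ?_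
    have eL : L b k (F.applyF b G) = fun η => ∑ l,
        L b k (fun η => F.c l * L b l G η + kerOp (convKer (F.θ l)) (L b l G) η) η := by
      ext η; simp only [L, applyF, Finset.mul_sum]
    rw [eL, (hKr k).kerOp_finset_sum _ (fun l => inH_L b k (hterm l))]
  rw [hleft, hright, Finset.sum_comm]
  unfold QF
  rw [← Finset.sum_add_distrib]
  refine Finset.sum_congr rfl fun k _ => ?_
  rw [← Finset.sum_add_distrib]
  refine Finset.sum_congr rfl fun l _ => ?_
  exact F.term_comm b hδ k l hG ξ

/-! ### The bound of `Q_δ`, uniform in `δ` -/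

/-- **`‖Q_δ G‖_t ≤ C ‖G‖_t` uniformly in `δ ≥ 0`.** [folklore] -/
theorem rn_QF_le (t : ℝ) : ∃ C : ℝ, 0 ≤ C ∧ ∀ {δ : ℝ}, 0 ≤ δ → ∀ {G : V → ℂ}, InH t G →
    InH t (F.QF b δ G) ∧ rn t (F.QF b δ G) ≤ C * rn t G := by
  -- the four families of constants
  set c1 : ι → ι → ℝ := fun k l => ‖F.c l‖ *
    schurConst V t (fun N => dreg * (2 * Real.pi * ‖b l‖ * F.D k (N + ⌈Mreg⌉₊ + 1))) *
      (2 * Real.pi * ‖b k‖) with hc1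
  set c2 : ι → ι → ℝ := fun k l => schurConst V t (F.D l) *
    schurConst V t (fun N => dreg * (2 * Real.pi * ‖b l‖ * F.D k (N + ⌈Mreg⌉₊ + 1))) *
      (2 * Real.pi * ‖b k‖) with hc2
  set c3 : ι → ι → ℝ := fun k l => schurConst V t (dcommConst V ((4 * (5 / 4) + 2 * (1 / 2)) * 2 ^ |(0 : ℝ) - 2|)
      (|(0 : ℝ) - 2| + 1) (F.D l) (F.D k)) * (2 * Real.pi * ‖b l‖) * (2 * Real.pi * ‖b k‖) with hc3
  set c4 : ι → ι → ℝ := fun k l => schurConst V t (fun N => dreg * F.D k (N + ⌈Mreg⌉₊)) *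
    schurConst V (t - 1) (fun N => 2 * Real.pi * ‖b k‖ * F.D l (N + 1)) * (2 * Real.pi * ‖b l‖) with hc4
  have hc10 : ∀ k l, 0 ≤ c1 k l := fun k l => by
    simp only [hc1]
    exact mul_nonneg (mul_nonneg (norm_nonneg _) (schurConst_nonneg (fun N => mul_nonneg dreg_nonneg
      (mul_nonneg (by positivity) ((F.decay k).nonneg _))) _)) (by positivity)
  have hc20 : ∀ k l, 0 ≤ c2 k l := fun k l => by
    simp only [hc2]
    exact mul_nonneg (mul_nonneg (schurConst_nonneg (F.decay l).nonneg _) (schurConst_nonneg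
      (fun N => mul_nonneg dreg_nonneg (mul_nonneg (by positivity) ((F.decay k).nonneg _))) _)) (by positivity)
  have hc30 : ∀ k l, 0 ≤ c3 k l := fun k l => by
    simp only [hc3]
    refine mul_nonneg (mul_nonneg (schurConst_nonneg (fun N => ?_) _) (by positivity)) (by positivity)
    exact ((mulDiff2_reg (V := V) le_rfl).kerDecay_dcommKer (F.decay l) (F.decay k)).nonneg N
  have hc40 : ∀ k l, 0 ≤ c4 k l := fun k l => by
    simp only [hc4]
    exact mul_nonneg (mul_nonneg (schurConst_nonneg (fun N => mul_nonneg dreg_nonneg ((F.decay k).nonneg _)) _)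
      (schurConst_nonneg (fun N => mul_nonneg (by positivity) ((F.decay l).nonneg _)) _)) (by positivity)
  refine ⟨∑ k, ∑ l, (c1 k l + c2 k l + c3 k l + c4 k l),
    Finset.sum_nonneg fun k _ => Finset.sum_nonneg fun l _ => by
      have := hc10 k l; have := hc20 k l; have := hc30 k l; have := hc40 k l; positivity,
    fun {δ} hδ {G} hG => ?_⟩
  have hKr := fun k => F.kerDecay_Kr hδ k
  have hKp := fun k l => F.kerDecay_Kp b hδ k l
  have hA := fun l => (F.decay l).kerDecay_convKer
  have hLk : ∀ k, InH (t - 1) (L b k G) := fun k => inH_L b k hG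
  have hLn : ∀ k, rn (t - 1) (L b k G) ≤ 2 * Real.pi * ‖b k‖ * rn t G := fun k => rn_linMul_le (b k) t hG
  have hW : ∀ k l, InH (t - 1 - 1) (L b l (L b k G)) := fun k l => inH_L b l (hLk k)
  have hWn : ∀ k l, rn (t - 1 - 1) (L b l (L b k G)) ≤ (2 * Real.pi * ‖b l‖) * (2 * Real.pi * ‖b k‖) * rn t G :=
    fun k l => by
      have h := rn_linMul_le (b l) (t - 1) (hLk k)
      exact h.trans (by nlinarith only [hLn k, mul_le_mul_of_nonneg_left (hLn k) (by positivity : (0:ℝ) ≤ 2 * Real.pi * ‖b l‖)])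
  -- the four terms, `InH t` and bounded
  have T1 : ∀ k l, InH t (fun ξ => F.c l * kerOp (F.Kp b δ k l) (L b k G) ξ) ∧
      rn t (fun ξ => F.c l * kerOp (F.Kp b δ k l) (L b k G) ξ) ≤ c1 k l * rn t G := fun k l => by
    have h := (hKp k l).inH_kerOp (hLk k)
    rw [show t - 1 - (-1 : ℝ) = t by ring] at h
    refine ⟨h.const_mul _, ?_⟩
    rw [rn_const_mul]
    have h1 := (hKp k l).rn_kerOp_le (t - 1) (hLk k)
    rw [show t - 1 - (-1 : ℝ) = t by ring] at h1
    simp only [hc1]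
    have h0 := schurConst_nonneg (V := V) (fun N => mul_nonneg dreg_nonneg
      (mul_nonneg (by positivity : (0:ℝ) ≤ 2 * Real.pi * ‖b l‖) ((F.decay k).nonneg (N + ⌈Mreg⌉₊ + 1)))) t
    calc ‖F.c l‖ * rn t (kerOp (F.Kp b δ k l) (L b k G))
        ≤ ‖F.c l‖ * (schurConst V t (fun N => dreg * (2 * Real.pi * ‖b l‖ * F.D k (N + ⌈Mreg⌉₊ + 1))) *
            (2 * Real.pi * ‖b k‖ * rn t G)) :=
          mul_le_mul_of_nonneg_left (h1.trans (mul_le_mul_of_nonneg_left (hLn k) h0)) (norm_nonneg _)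
      _ = _ := by ring
  have T2 : ∀ k l, InH t (kerOp (convKer (F.θ l)) (kerOp (F.Kp b δ k l) (L b k G))) ∧
      rn t (kerOp (convKer (F.θ l)) (kerOp (F.Kp b δ k l) (L b k G))) ≤ c2 k l * rn t G := fun k l => by
    have h := (hKp k l).inH_kerOp (hLk k)
    rw [show t - 1 - (-1 : ℝ) = t by ring] at h
    have h' := (hA l).inH_kerOp h
    rw [sub_zero] at h'
    refine ⟨h', ?_⟩
    have h1 := (hA l).rn_kerOp_le t h
    rw [sub_zero] at h1
    have h2 := (hKp k l).rn_kerOp_le (t - 1) (hLk k)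
    rw [show t - 1 - (-1 : ℝ) = t by ring] at h2
    simp only [hc2]
    have h0 := schurConst_nonneg (V := V) (fun N => mul_nonneg dreg_nonneg
      (mul_nonneg (by positivity : (0:ℝ) ≤ 2 * Real.pi * ‖b l‖) ((F.decay k).nonneg (N + ⌈Mreg⌉₊ + 1)))) t
    have h0' := schurConst_nonneg (V := V) (F.decay l).nonneg t
    calc rn t (kerOp (convKer (F.θ l)) (kerOp (F.Kp b δ k l) (L b k G)))
        ≤ schurConst V t (F.D l) * (schurConst V t (fun N => dreg * (2 * Real.pi * ‖b l‖ * F.D k (N + ⌈Mreg⌉₊ + 1))) *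
            (2 * Real.pi * ‖b k‖ * rn t G)) :=
          h1.trans (mul_le_mul_of_nonneg_left (h2.trans (mul_le_mul_of_nonneg_left (hLn k) h0)) h0')
      _ = _ := by ring
  have T3 : ∀ k l, InH t (kerOp (dcommKer (F.θ l) (F.θ k) (reg δ)) (L b l (L b k G))) ∧
      rn t (kerOp (dcommKer (F.θ l) (F.θ k) (reg δ)) (L b l (L b k G))) ≤ c3 k l * rn t G := fun k l => by
    have hD := (mulDiff2_reg (V := V) hδ).kerDecay_dcommKer (F.decay l) (F.decay k)
    have h := hD.inH_kerOp (hW k l)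
    rw [show t - 1 - 1 - (-2 : ℝ) = t by ring] at h
    refine ⟨h, ?_⟩
    have h1 := hD.rn_kerOp_le (t - 1 - 1) (hW k l)
    rw [show t - 1 - 1 - (-2 : ℝ) = t by ring] at h1
    simp only [hc3]
    have h0 := schurConst_nonneg (V := V) hD.nonneg t
    calc rn t (kerOp (dcommKer (F.θ l) (F.θ k) (reg δ)) (L b l (L b k G)))
        ≤ schurConst V t (dcommConst V ((4 * (5 / 4) + 2 * (1 / 2)) * 2 ^ |(0 : ℝ) - 2|)
            (|(0 : ℝ) - 2| + 1) (F.D l) (F.D k)) * ((2 * Real.pi * ‖b l‖) * (2 * Real.pi * ‖b k‖) * rn t G) :=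
          h1.trans (mul_le_mul_of_nonneg_left (hWn k l) h0)
      _ = _ := by ring
  have T4 : ∀ k l, InH t (kerOp (F.Kr δ k) (kerOp (convKer (fun ζ => linMul (b k) ζ * F.θ l ζ)) (L b l G))) ∧
      rn t (kerOp (F.Kr δ k) (kerOp (convKer (fun ζ => linMul (b k) ζ * F.θ l ζ)) (L b l G))) ≤
        c4 k l * rn t G := fun k l => by
    have hC := ((F.decay l).linMul_mul (b k)).kerDecay_convKer
    have h := hC.inH_kerOp (hLk l)
    rw [sub_zero] at h
    have h' := (hKr k).inH_kerOp h
    rw [show t - 1 - (-1 : ℝ) = t by ring] at h'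
    refine ⟨h', ?_⟩
    have h1 := (hKr k).rn_kerOp_le (t - 1) h
    rw [show t - 1 - (-1 : ℝ) = t by ring] at h1
    have h2 := hC.rn_kerOp_le (t - 1) (hLk l)
    rw [sub_zero] at h2
    simp only [hc4]
    have h0 := schurConst_nonneg (V := V) (fun N => mul_nonneg dreg_nonneg ((F.decay k).nonneg (N + ⌈Mreg⌉₊))) t
    have h0' := schurConst_nonneg (V := V) (fun N => mul_nonneg (by positivity : (0:ℝ) ≤ 2 * Real.pi * ‖b k‖)
      ((F.decay l).nonneg (N + 1))) (t - 1)
    calc rn t (kerOp (F.Kr δ k) (kerOp (convKer (fun ζ => linMul (b k) ζ * F.θ l ζ)) (L b l G)))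
        ≤ schurConst V t (fun N => dreg * F.D k (N + ⌈Mreg⌉₊)) *
            (schurConst V (t - 1) (fun N => 2 * Real.pi * ‖b k‖ * F.D l (N + 1)) *
              (2 * Real.pi * ‖b l‖ * rn t G)) :=
          h1.trans (mul_le_mul_of_nonneg_left (h2.trans (mul_le_mul_of_nonneg_left (hLn l) h0')) h0)
      _ = _ := by ring
  -- sum up
  have hinner : ∀ k l, InH t (fun ξ => F.c l * kerOp (F.Kp b δ k l) (L b k G) ξ +
      kerOp (convKer (F.θ l)) (kerOp (F.Kp b δ k l) (L b k G)) ξ +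
      kerOp (dcommKer (F.θ l) (F.θ k) (reg δ)) (L b l (L b k G)) ξ -
      kerOp (F.Kr δ k) (kerOp (convKer (fun ζ => linMul (b k) ζ * F.θ l ζ)) (L b l G)) ξ) ∧
      rn t (fun ξ => F.c l * kerOp (F.Kp b δ k l) (L b k G) ξ +
        kerOp (convKer (F.θ l)) (kerOp (F.Kp b δ k l) (L b k G)) ξ +
        kerOp (dcommKer (F.θ l) (F.θ k) (reg δ)) (L b l (L b k G)) ξ -
        kerOp (F.Kr δ k) (kerOp (convKer (fun ζ => linMul (b k) ζ * F.θ l ζ)) (L b l G)) ξ) ≤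
        (c1 k l + c2 k l + c3 k l + c4 k l) * rn t G := fun k l => by
    obtain ⟨i1, b1⟩ := T1 k l
    obtain ⟨i2, b2⟩ := T2 k l
    obtain ⟨i3, b3⟩ := T3 k l
    obtain ⟨i4, b4⟩ := T4 k l
    refine ⟨((i1.add i2).add i3).sub i4, ?_⟩
    refine (((i1.add i2).add i3).rn_sub_le i4).trans ?_
    refine (add_le_add (((i1.add i2).rn_add_le i3).trans (add_le_add (i1.rn_add_le i2) le_rfl)) le_rfl).trans ?_
    nlinarith only [b1, b2, b3, b4]
  unfold QF
  refine ⟨InH.finset_sum _ fun k => InH.finset_sum _ fun l => (hinner k l).1, ?_⟩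
  refine (InH.rn_finset_sum_le _ fun k => InH.finset_sum _ fun l => (hinner k l).1).trans ?_
  rw [Finset.sum_mul]
  refine Finset.sum_le_sum fun k _ => ?_
  refine (InH.rn_finset_sum_le _ fun l => (hinner k l).1).trans ?_
  rw [Finset.sum_mul]
  exact Finset.sum_le_sum fun l _ => (hinner k l).2

end FlatField

end Literature.Analysis.Hypoelliptic
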